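import Mathlib
import Summits.Ventures.PercRepro.TriangleCapFourRowThreeSecondBest
import Summits.Ventures.PercRepro.TriangleCapFiveRowThree

/-!
# PercRepro — THE NON-BIPARTITE STABILITY TABLE AT `r = 3` ON THE ROWS `a = 3, 4, 5` IN ONE STATEMENT:
the non-bipartite gap is `2 (k − 2a − 1)` on every cell `(k, a, 3)`, `3 ≤ a ≤ 5` (p3, gen 46; part 199n)

The three rows have three different mechanisms — the family `T = 2 (k − 7)` on `(k, 3, 3)` (part 193, `r ≥ 1`), the
other bipartition `B2 = 2 (k − 9)` on `(k, 4, 3)` (part 199d), the family `T = 2k − 22` on `(k, 5, 3)` (part 199i) —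
and one formula: `nonbipGap k a 3 = 2 (k − 2a − 1)` for `a ∈ {3, 4, 5}`, attained by `tFamilyGen (k − 1) 3 2`,
`bipMinusStar k 5 (k − 6)`, `tFamilyGen (k − 1) 5 0`. (On the rows `a ≥ 6` the conjectured gap is
`B2 = 2 (k − 2a − 1)(a − 3)`, a different shape.) Axioms: standard.
-/

namespace PercRepro

namespace TriangleCap

namespace C047

open Finset

/-- **THE NON-BIPARTITE SECOND-BEST VALUE AT `r = 3` ON THE ROWS `a = 3, 4, 5`:** for `2a + 3 ≤ k`, `10 ≤ k`, every
non-`a`-bipartite `K₄⁻`-free graph on `Fin k` with `a (k − a) − 3` edges has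
`Σ_v d(v)² + 3 (k − 4) + 2 (k − 2a − 1) ≤ m k`, and the value is attained by a non-`a`-bipartite graph. -/
theorem nonbip_second_best_r_three (a k : ℕ) (ha3 : 3 ≤ a) (ha5 : a ≤ 5) (hk : 2 * a + 3 ≤ k) (hk10 : 10 ≤ k) :
    (∀ (D : SimpleGraph (Fin k)) [DecidableRel D.Adj], K4mFree D → D.edgeFinset.card + 3 = a * (k - a) →
        (¬ ∃ A : Finset (Fin k), A.card = a ∧ BipSub D A) →
        ∑ v, deg D v * deg D v + 3 * (k - 4) + 2 * (k - 2 * a - 1) ≤ D.edgeFinset.card * k) ∧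
      ∃ (D : SimpleGraph (Fin k)) (_ : DecidableRel D.Adj), K4mFree D ∧ D.edgeFinset.card + 3 = a * (k - a) ∧
        (¬ ∃ A : Finset (Fin k), A.card = a ∧ BipSub D A) ∧
        ∑ v, deg D v * deg D v + 3 * (k - 4) + 2 * (k - 2 * a - 1) = D.edgeFinset.card * k := by
  have hcard : Fintype.card (Fin k) = k := Fintype.card_fin k
  interval_cases a
  · -- the row `a = 3`: the family `T = 2 (k − 7)`
    refine ⟨?_, ?_⟩
    · intro D _ hK hm hnb
      rcases three_row_second_order D hK 3 (by omega) (by rw [hcard]; omega) with h | h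
      · exact absurd h hnb
      · rw [hcard] at h
        simp only [show (3 : ℕ) = 0 ↔ False from by norm_num, if_false, add_zero] at h
        have e1 : k - 1 - 3 = k - 4 := by omega
        have e2 : 2 * (k - 2 * 3 - 1) = 2 * (k - 7) := by omega
        rw [e1] at h
        rw [e2]
        exact h
    · obtain ⟨n, rfl⟩ : ∃ n, k = n + 1 := ⟨k - 1, by omega⟩
      obtain ⟨hK, hE, hS, hnb⟩ := tFamilyGen_value n 3 2 (by norm_num) (by omega) (by omega)
      refine ⟨tFamilyGen n 3 2 (by omega), inferInstance, hK, ?_, fun ⟨A, _, hB⟩ => hnb A hB, ?_⟩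
      · have e : 2 + 3 - 2 = 3 := by norm_num
        rw [e] at hE
        exact hE
      · have e : 2 + 3 - 2 = 3 := by norm_num
        rw [e] at hS
        have e1 : n + 1 - 1 - 3 = n + 1 - 4 := by omega
        rw [e1] at hS
        omega
  · -- the row `a = 4`: the other bipartition `B2 = 2 (k − 9)`
    obtain ⟨h1, D, inst, hK, hE, hnb, hS⟩ := four_three_nonbip_second_best k (by omega)
    refine ⟨?_, D, inst, hK, hE, hnb, ?_⟩
    · intro D' _ hK' hm' hnb'
      have := h1 D' hK' hm' hnb'
      have e : 2 * (k - 2 * 4 - 1) = 2 * k - 18 := by omega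
      rw [e]
      exact this
    · have e : 2 * (k - 2 * 4 - 1) = 2 * k - 18 := by omega
      rw [e]
      exact hS
  · -- the row `a = 5`: the family `T = 2k − 22`
    obtain ⟨h1, D, inst, hK, hE, hnb, hS⟩ := five_three_nonbip_second_best k (by omega)
    refine ⟨?_, D, inst, hK, hE, fun ⟨A, _, hB⟩ => hnb A hB, ?_⟩
    · intro D' _ hK' hm' hnb'
      have := h1 D' hK' hm' hnb'
      have e : 2 * (k - 2 * 5 - 1) = 2 * k - 22 := by omega
      rw [e]
      exact this
    · have e : 2 * (k - 2 * 5 - 1) = 2 * k - 22 := by omega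
      rw [e]
      exact hS

end C047

end TriangleCap

end PercRepro
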